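/-
Copyright (c) 2026. All rights reserved.
Released under Apache 2.0 license as described in the file LICENSE.
Authors: abc-iut cell, cone prover seat abc-iut-w6-d031 (gen 4; UNIF Tier-2 brick P7 «uniformised-base
junction», part 3: the Möbius deck groups of `ℂ ∖ F` and of the once-punctured elliptic curve are FREE,
and the geometric column of [AbsTopIII] Prop 4.2 (i) / Cor 4.5 transports to these GENUINE bases).
-/
import Literature.AnabelianGeometry.AbsoluteAnabelian.ArchimedeanHolFieldFunctorGeometricPSLUniformisedBasePlane
import Literature.AnabelianGeometry.AbsoluteAnabelian.ArchimedeanHolFieldFunctorGeometricPSLSlim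
import Literature.AnabelianGeometry.AbsoluteAnabelian.ArchimedeanHolFieldFunctorGeometricRCPSLIdRigid
import Literature.AnabelianGeometry.AbsoluteAnabelian.ArchimedeanHolFieldFunctorGeometricOverIdRigidTorus
import Mathlib.GroupTheory.FreeGroup.GeneratorEquiv
import HarnessLib

/-!
# The Möbius deck groups of `ℂ ∖ F` and of `E ∖ {x₀}` are free; [AbsTopIII] Prop 4.2 (i) / Cor 4.5 at
# these GENUINE bases by the uniformisation route (PROOF-ONLY)

Topic `Literature/AnabelianGeometry/AbsoluteAnabelian`; part 3 of the uniformised-base junction (parts 1–2: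
`…PSLUniformisedBase`, `…PSLUniformisedBasePlane`).  S. Mochizuki, *Topics in absolute anabelian geometry
III*, proof of Prop 4.2 (i), kurims p.106 l.11–19: «for any object `X` of `EA`, the full subcategory of
`EA` consisting of objects that map to `X` may … be identified with the category of finite étale
R-localizations `Loc_R(X)` … [id-rigid by] the slimness assertion of Lemma 4.3; thus, the id-rigidity of
`EA` follows»; Cor 4.5 pp.107–109.

abc-iut-L4-t14's column proves exactly this AT THE UNIFORMISED MODEL `X₀ = ℍ/Γ̄` for `Γ̄ ≤ PSL₂(ℝ)` FREE
of rank `≥ 2` acting freely and properly discontinuously (`isIdRigid_EA_mapsTo_pslQuotient_of_isFreeGroup`,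
`cor_4_5_geometric_mapsTo_pslQuotient_of_isFreeGroup`, `RC.isIdRigid_mapsTo_pslQuotient_of_mulEquiv_freeGroup`),
under its two declared finiteness residuals `hfin` (finite fibres of conjugation-induced maps) and `hN`
(`[N(Λ̄) : Λ̄] < ∞`).  Parts 1–2 put genuine Riemann surfaces at `X₀` (`pslQuotient Λ̄ ≅ X`, `Λ̄ ≃* π₁(X)`);
this part adds the FREENESS of `Λ̄` from the tree's `π₁(ℂ ∖ F) ≅ F_{|F|}`
(`nonempty_mulEquiv_freeGroup_compl_finite`) and `π₁(E ∖ {x₀}) ≅ F₂`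
(`HolRS.nonempty_mulEquiv_freeGroup_puncturedTorus`), and transports the column along the isomorphism
of bases (the property «maps to `X`» is invariant under `X ≅ X'`):

* `HolRS.nonempty_hom_eq_of_iso` — «objects mapping to `X`» = «objects mapping to `X'`» for `X ≅ X'`
  (any category); `HolRS.exists_isFreeGroup_of_mulEquiv` — rank bookkeeping `G ≃* F_m ⇒ IsFreeGroup G`
  with `|Generators| = m`.
* `HolRS.exists_pslQuotient_iso_of_cover_transport` — part 1's junction with the transport clause: for any
  holomorphic covering `k : ℍ → X`, `(Y ↦ Nonempty (Y ⟶ pslQuotient Λ̄)) = (Y ↦ Nonempty (Y ⟶ X))` and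
  the same in print's RC-category (`toRC`).
* ★ `HolRS.exists_pslQuotient_iso_planeComplFinite_freeGroup` — **the Möbius deck group of `ℂ ∖ F`
  (`2 ≤ |F| < ∞`) is FREE OF RANK `|F|`**, with `pslQuotient Λ̄ ≅ planeComplFinite F` — UNCONDITIONAL;
  ★ `HolRS.exists_pslQuotient_iso_puncturedTorus_freeGroup` — **the Möbius deck group of the
  once-punctured elliptic curve `E ∖ {x₀}` (`E = ℂ/Φ(ℤ²)`) is FREE OF RANK 2**, with
  `pslQuotient Λ̄ ≅ puncturedTorus Φ x₀` — UNCONDITIONAL.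
* ★★ `HolRS.isIdRigid_EA_mapsTo_planeComplFinite_of_finiteness` /
  `HolRS.isIdRigid_EA_mapsTo_puncturedTorus_of_finiteness` — **[AbsTopIII] Prop 4.2 (i) («the geometric
  `EA` of objects mapping to `X` is id-rigid») AND Cor 4.5 (i)–(v) AT THE GENUINE `X = ℂ ∖ F`
  (`2 ≤ |F|`) and `X = E ∖ {x₀}`, by print's own route (uniformisation + Lemma 4.3), modulo ONLY L4-t14's
  two finiteness residuals `hfin`, `hN` on the Möbius deck group** — together with the print-faithful
  RC-category version modulo `hfin`, `hN'`.  For `X = E ∖ {x₀}` and for `|F| ≥ 3` this is the FIRST route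
  in the tree to the `EA`-level statement at these genuine objects: the (H1)-route of
  abc-iut-L4-t12 / abc-iut-L4-t10 needs every automorphism of `X` to be detected on `π₁`, which FAILS at `E ∖ {x₀}`
  (central involution, abc-iut-w6-d003's VACUITY-H1) and is only available for `|F| = 2`.

Everything is a theorem; no definition, no instance, no named fact.  HONEST FRAMING: the finiteness
residuals `hfin`/`hN`/`hN'` are hypotheses (classically true — finite-type Fuchsian groups — but not in the
tree); MODEL ≠ reconstruction; nothing here bears on the disputed [IUTchIII] Cor. 3.12.

## References

* S. Mochizuki, *Topics in Absolute Anabelian Geometry III* (2015), proof of Prop. 4.2 (i) p.106,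
  Cor. 4.5 pp.107–109, Def. 4.1 (i) p.101. [MochizukiAbsTopIII2015]
* H. M. Farkas, I. Kra, *Riemann Surfaces*, 2nd ed. (1992), IV.5.5–IV.5.6. [FarkasKra1992]
* R. C. Lyndon, P. E. Schupp, *Combinatorial Group Theory* (2001), Ch. I Prop. 2.7 (free bases are
  equipotent). [LyndonSchupp2001]
-/

set_option autoImplicit false

noncomputable section

namespace Literature.AnabelianGeometry.AbsoluteAnabelian

namespace HolRS

open scoped _root_.Manifold _root_.ContDiff _root_.Topology UpperHalfPlane MatrixGroups
open _root_.MulAction _root_.Function _root_.Set _root_.CategoryTheory _root_.TopologicalSpace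
open Matrix.ProjectiveSpecialLinearGroup (toPGL)
open Literature.Geometry.Kaehler (ComplexTorus)

/-! ### §1 Transport along an isomorphism of bases; rank bookkeeping -/

/-- «Objects mapping to `X`» = «objects mapping to `X'`» whenever `X ≅ X'` (compose with `e.hom`,
`e.inv`). [folklore] [cite: MochizukiAbsTopIII2015, Proposition 4.2 (i) proof p.106] -/
theorem nonempty_hom_eq_of_iso {C : Type*} [Category C] {X X' : C} (e : X ≅ X') :
    (fun Y : C => Nonempty (Y ⟶ X)) = fun Y : C => Nonempty (Y ⟶ X') :=
  funext fun _ => propext ⟨fun ⟨f⟩ => ⟨f ≫ e.hom⟩, fun ⟨f⟩ => ⟨f ≫ e.inv⟩⟩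

/-- Rank bookkeeping: a group isomorphic to `F_m` is free in Mathlib's sense with a finite chosen basis
of cardinality `m` (free bases of one group are equipotent, `Equiv.ofFreeGroupEquiv`).
[cite: LyndonSchupp2001, Ch. I Prop. 2.7] -/
theorem exists_isFreeGroup_of_mulEquiv {G : Type} [Group G] {m : ℕ} (e : G ≃* FreeGroup (Fin m)) :
    ∃ (_ : IsFreeGroup G) (_ : Finite (IsFreeGroup.Generators G)),
      Nat.card (IsFreeGroup.Generators G) = m := by
  haveI : IsFreeGroup G := IsFreeGroup.ofMulEquiv e.symm
  let ε : IsFreeGroup.Generators G ≃ Fin m :=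
    Equiv.ofFreeGroupEquiv ((IsFreeGroup.toFreeGroup G).symm.trans e)
  haveI : Finite (IsFreeGroup.Generators G) := Finite.of_equiv _ ε.symm
  exact ⟨inferInstance, inferInstance, by rw [Nat.card_congr ε, Nat.card_eq_fintype_card, Fintype.card_fin]⟩

/-! ### §2 The junction with its transport clauses -/

/-- **Part 1's junction with the transport clauses**: for a holomorphic covering `k : ℍ → X` of
`X ∈ HolRS`, the Möbius deck group `Λ̄` (membership criterion), acting freely and properly
discontinuously, with `π₁(X) ≃* Λ̄`, an isomorphism `pslQuotient Λ̄ ≅ X`, and the EQUALITY of the object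
properties «maps to `pslQuotient Λ̄`» = «maps to `X`» both in `HolRS` and in print's RC-category — so every
statement of the geometric column about «objects mapping to `X₀ = ℍ/Λ̄`» IS the statement about «objects
mapping to `X`». [cite: MochizukiAbsTopIII2015, Proposition 4.2 (i) proof p.106]
[cite: FarkasKra1992, IV.5.5–IV.5.6] -/
theorem exists_pslQuotient_iso_of_cover_transport (X : HolRS) {k : ℍ → X.carrier}
    (hk : IsCoveringMap k) (dk : MDifferentiable 𝓘(ℂ, ℂ) 𝓘(ℂ, ℂ) k) :
    ∃ (Λ : Subgroup PSL2R) (_ : ProperlyDiscontinuousSMul Λ ℍ) (_ : IsCancelSMul Λ ℍ),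
      (∀ q : PSL2R, q ∈ Λ ↔ ∀ τ : ℍ, k (q • τ) = k τ) ∧
      (∀ x : X.carrier, Nonempty (FundamentalGroup X.carrier x ≃* Λ)) ∧
      Nonempty (pslQuotient Λ ≅ X) ∧
      ((fun Y : HolRS => Nonempty (Y ⟶ pslQuotient Λ)) = fun Y : HolRS => Nonempty (Y ⟶ X)) ∧
      ((fun Y : RC => Nonempty (Y ⟶ toRC.obj (pslQuotient Λ))) =
        fun Y : RC => Nonempty (Y ⟶ toRC.obj X)) := by
  obtain ⟨Λ, hPD, hC, hΛ, hπ, e, -⟩ := exists_pslQuotient_iso_of_cover_pi1 X hk dk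
  exact ⟨Λ, hPD, hC, hΛ, hπ, ⟨e⟩, nonempty_hom_eq_of_iso e, nonempty_hom_eq_of_iso (toRC.mapIso e)⟩

/-! ### §3 Free Möbius deck groups: `ℂ ∖ F` and the once-punctured elliptic curve -/

/-- ★ **The Möbius deck group of `ℂ ∖ F` is free of rank `|F|`** (`F ⊆ ℂ` finite, `2 ≤ |F|`) —
UNCONDITIONAL: there are a holomorphic covering `k : ℍ → ℂ ∖ F`, its Möbius deck group `Λ̄ ≤ PSL₂(ℝ)`
(membership criterion) acting freely and properly discontinuously, `Λ̄ ≃* F_{|F|}` (part 1's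
`Λ̄ ≃* π₁` composed with the tree's `π₁(ℂ ∖ F) ≅ F_{|F|}`, `nonempty_mulEquiv_freeGroup_compl_finite`),
an isomorphism `pslQuotient Λ̄ ≅ planeComplFinite F hF` and the two transport equalities.
[cite: MochizukiAbsTopIII2015, Definition 4.1 (i) p.101] [cite: FarkasKra1992, IV.5.5–IV.5.6] -/
theorem exists_pslQuotient_iso_planeComplFinite_freeGroup {F : Set ℂ} (hF : F.Finite)
    (h2 : 2 ≤ F.ncard) :
    ∃ (k : ℍ → (planeComplFinite F hF).carrier) (Λ : Subgroup PSL2R)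
      (_ : ProperlyDiscontinuousSMul Λ ℍ) (_ : IsCancelSMul Λ ℍ),
      IsCoveringMap k ∧ MDifferentiable 𝓘(ℂ, ℂ) 𝓘(ℂ, ℂ) k ∧
      (∀ q : PSL2R, q ∈ Λ ↔ ∀ τ : ℍ, k (q • τ) = k τ) ∧
      Nonempty (Λ ≃* FreeGroup (Fin F.ncard)) ∧
      Nonempty (pslQuotient Λ ≅ planeComplFinite F hF) ∧
      ((fun Y : HolRS => Nonempty (Y ⟶ pslQuotient Λ)) =
        fun Y : HolRS => Nonempty (Y ⟶ planeComplFinite F hF)) ∧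
      ((fun Y : RC => Nonempty (Y ⟶ toRC.obj (pslQuotient Λ))) =
        fun Y : RC => Nonempty (Y ⟶ toRC.obj (planeComplFinite F hF))) := by
  obtain ⟨k, Λ₀, _, _, hk, dk, -, -, -, -, -⟩ := exists_pslQuotient_iso_planeComplFinite hF h2
  obtain ⟨Λ, hPD, hC, hΛ, hπ, he, hH, hR⟩ :=
    exists_pslQuotient_iso_of_cover_transport (planeComplFinite F hF) hk dk
  obtain ⟨x⟩ : Nonempty (planeComplFinite F hF).carrier := inferInstance
  obtain ⟨φ⟩ := hπ x
  obtain ⟨ψ⟩ :=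
    Literature.AlgebraicTopology.FundamentalGroup.nonempty_mulEquiv_freeGroup_compl_finite hF x
  exact ⟨k, Λ, hPD, hC, hk, dk, hΛ, ⟨φ.symm.trans ψ⟩, he, hH, hR⟩

/-- ★ **The Möbius deck group of the once-punctured elliptic curve `E ∖ {x₀}` is free of rank 2**
(`E = ℂ/Φ(ℤ²)`, abc-iut-L4-t12's object `puncturedTorus Φ x₀`) — UNCONDITIONAL: the disc covers `E ∖ {x₀}`
holomorphically (`ComplexTorus.exists_disc_covering_compl_finite'`, Tier 1), so part 1 gives a holomorphic
`ℍ`-covering `k`, the Möbius deck group `Λ̄` with `pslQuotient Λ̄ ≅ puncturedTorus Φ x₀`, and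
`Λ̄ ≃* π₁(E ∖ {x₀}) ≃* F₂` (`nonempty_mulEquiv_freeGroup_puncturedTorus`); plus the transport equalities.
[cite: MochizukiAbsTopIII2015, Definition 4.1 (i) p.101] [cite: FarkasKra1992, IV.6.1] -/
theorem exists_pslQuotient_iso_puncturedTorus_freeGroup (Φ : (Fin 2 → ℝ) ≃L[ℝ] ℂ)
    (x₀ : ComplexTorus Φ) :
    ∃ (k : ℍ → (puncturedTorus Φ x₀).carrier) (Λ : Subgroup PSL2R)
      (_ : ProperlyDiscontinuousSMul Λ ℍ) (_ : IsCancelSMul Λ ℍ),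
      IsCoveringMap k ∧ MDifferentiable 𝓘(ℂ, ℂ) 𝓘(ℂ, ℂ) k ∧
      (∀ q : PSL2R, q ∈ Λ ↔ ∀ τ : ℍ, k (q • τ) = k τ) ∧
      Nonempty (Λ ≃* FreeGroup (Fin 2)) ∧
      Nonempty (pslQuotient Λ ≅ puncturedTorus Φ x₀) ∧
      ((fun Y : HolRS => Nonempty (Y ⟶ pslQuotient Λ)) =
        fun Y : HolRS => Nonempty (Y ⟶ puncturedTorus Φ x₀)) ∧
      ((fun Y : RC => Nonempty (Y ⟶ toRC.obj (pslQuotient Λ))) =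
        fun Y : RC => Nonempty (Y ⟶ toRC.obj (puncturedTorus Φ x₀))) := by
  obtain ⟨p, hp, -, dp⟩ := ComplexTorus.exists_disc_covering_compl_finite' Φ
    (Set.finite_singleton x₀) (Set.singleton_nonempty x₀)
  obtain ⟨k, Λ₀, _, _, hk, dk, -, -, -, -, -⟩ :=
    exists_pslQuotient_iso_of_disc_cover (puncturedTorus Φ x₀) hp dp
  obtain ⟨Λ, hPD, hC, hΛ, hπ, he, hH, hR⟩ :=
    exists_pslQuotient_iso_of_cover_transport (puncturedTorus Φ x₀) hk dk
  obtain ⟨y⟩ : Nonempty (puncturedTorus Φ x₀).carrier := inferInstance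
  obtain ⟨φ⟩ := hπ y
  obtain ⟨ψ⟩ := nonempty_mulEquiv_freeGroup_puncturedTorus Φ x₀ y
  exact ⟨k, Λ, hPD, hC, hk, dk, hΛ, ⟨φ.symm.trans ψ⟩, he, hH, hR⟩

/-! ### §4 [AbsTopIII] Prop 4.2 (i) / Cor 4.5 at the genuine bases, modulo the finiteness residuals -/

/-- ★★ **[AbsTopIII] Prop 4.2 (i) and Cor 4.5 (i)–(v) AT THE GENUINE `X = ℂ ∖ F`** (`2 ≤ |F| < ∞`), by
print's route (uniformisation `X ≅ ℍ/Λ̄` + Lemma 4.3 for free `Λ̄` of rank `|F| ≥ 2`): for the Möbius deck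
group `Λ̄` of `ℂ ∖ F` — GRANTED abc-iut-L4-t14's two finiteness residuals `hfin` (finite fibres of the
conjugation-induced maps of `Loc(PSL₂(ℝ), Λ̄)`) and `hN` (`[N(Λ̄') : Λ̄'] < ∞` for every finite-index
`Λ̄' ≤ Λ̄`) — the geometric `EA` of connected Riemann surfaces mapping to `ℂ ∖ F` is ID-RIGID and the
archimedean log-Frobenius data over it satisfy Cor 4.5 AS TYPED; and, granted `hfin` and
`hN' : [N_{PGL₂(ℝ)}(Λ̄) : Λ̄] < ∞`, «objects of the RC-category mapping to `ℂ ∖ F`» is id-rigid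
(`isIdRigid_EA_mapsTo_pslQuotient_of_isFreeGroup`, `cor_4_5_geometric_mapsTo_pslQuotient_of_isFreeGroup`,
`RC.isIdRigid_mapsTo_pslQuotient_of_mulEquiv_freeGroup`, transported along `pslQuotient Λ̄ ≅ planeComplFinite F`).
[cite: MochizukiAbsTopIII2015, Proposition 4.2 (i) proof p.106]
[cite: MochizukiAbsTopIII2015, Corollary 4.5 pp.107–109] -/
theorem isIdRigid_EA_mapsTo_planeComplFinite_of_finiteness {F : Set ℂ} (hF : F.Finite)
    (h2 : 2 ≤ F.ncard) :
    ∃ (Λ : Subgroup PSL2R) (_ : ProperlyDiscontinuousSMul Λ ℍ) (_ : IsCancelSMul Λ ℍ),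
      Nonempty (Λ ≃* FreeGroup (Fin F.ncard)) ∧ Nonempty (pslQuotient Λ ≅ planeComplFinite F hF) ∧
      ∀ hfin : ∀ (g : PSL2R) (Λ₁ Λ₂ : _root_.Literature.AnabelianGeometry.AbsoluteAnabelian.LocObj Λ),
          (∀ x ∈ Λ₁.toSubgroup, g * x * g⁻¹ ∈ Λ₂.toSubgroup) →
          ((Literature.Geometry.Manifold.QuotientManifold.conjSubgroup g Λ₁.toSubgroup).subgroupOf
            Λ₂.toSubgroup).FiniteIndex,
        ((∀ Λ' : _root_.Literature.AnabelianGeometry.AbsoluteAnabelian.LocObj Λ,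
            (Λ'.toSubgroup.subgroupOf (Subgroup.normalizer (Λ'.toSubgroup : Set PSL2R))).FiniteIndex) →
          IsIdRigid (geometricAutHolFieldFunctor
              fun Y : HolRS => Nonempty (Y ⟶ planeComplFinite F hF)).EA ∧
            Literature.AnabelianGeometry.AbsoluteAnabelian.AbsTopIII.Cor_4_5
              (archLogFrobeniusData (geometricAutHolFieldFunctor
                fun Y : HolRS => Nonempty (Y ⟶ planeComplFinite F hF)))
              (archTelecoreData (geometricAutHolFieldFunctor
                fun Y : HolRS => Nonempty (Y ⟶ planeComplFinite F hF)))) ∧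
        (((Λ.map (toPGL (n := Fin 2) (R := ℝ))).subgroupOf
            (Subgroup.normalizer ((Λ.map (toPGL (n := Fin 2) (R := ℝ)) : Subgroup PGL(2, ℝ)) :
              Set PGL(2, ℝ)))).FiniteIndex →
          IsIdRigid (ObjectProperty.FullSubcategory
            fun Y : RC => Nonempty (Y ⟶ toRC.obj (planeComplFinite F hF)))) := by
  obtain ⟨-, Λ, hPD, hC, -, -, -, ⟨e⟩, hiso, hH, hR⟩ :=
    exists_pslQuotient_iso_planeComplFinite_freeGroup hF h2
  obtain ⟨hfree, hfinG, hcard⟩ := exists_isFreeGroup_of_mulEquiv e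
  have h2' : 2 ≤ Nat.card (IsFreeGroup.Generators Λ) := hcard ▸ h2
  refine ⟨Λ, hPD, hC, ⟨e⟩, hiso, fun hfin => ⟨fun hN => ⟨?_, ?_⟩, fun hN' => ?_⟩⟩
  · have h := isIdRigid_EA_mapsTo_pslQuotient_of_isFreeGroup Λ hfin h2' hN
    rw [hH] at h
    exact h
  · have h := cor_4_5_geometric_mapsTo_pslQuotient_of_isFreeGroup Λ hfin h2' hN
    rw [hH] at h
    exact h
  · haveI := hN'
    have h := RC.isIdRigid_mapsTo_pslQuotient_of_mulEquiv_freeGroup Λ hfin e h2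
    rw [hR] at h
    exact h

/-- ★★ **[AbsTopIII] Prop 4.2 (i) and Cor 4.5 (i)–(v) AT THE GENUINE ONCE-PUNCTURED ELLIPTIC CURVE
`E ∖ {x₀}`** (`E = ℂ/Φ(ℤ²)`), by print's route (uniformisation + Lemma 4.3 for the free Möbius deck group
`Λ̄ ≅ F₂`), modulo ONLY abc-iut-L4-t14's finiteness residuals `hfin`, `hN` (resp. `hfin`, `hN'` for the
print-faithful RC-category).  This is the first route in the tree to the `EA`-level statement at a curve
of type `(1,1)`: the (H1)-route cannot work there (every once-punctured elliptic curve has a central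
involution, abc-iut-w6-d003). [cite: MochizukiAbsTopIII2015, Proposition 4.2 (i) proof p.106]
[cite: MochizukiAbsTopIII2015, Corollary 4.5 pp.107–109] -/
theorem isIdRigid_EA_mapsTo_puncturedTorus_of_finiteness (Φ : (Fin 2 → ℝ) ≃L[ℝ] ℂ)
    (x₀ : ComplexTorus Φ) :
    ∃ (Λ : Subgroup PSL2R) (_ : ProperlyDiscontinuousSMul Λ ℍ) (_ : IsCancelSMul Λ ℍ),
      Nonempty (Λ ≃* FreeGroup (Fin 2)) ∧ Nonempty (pslQuotient Λ ≅ puncturedTorus Φ x₀) ∧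
      ∀ hfin : ∀ (g : PSL2R) (Λ₁ Λ₂ : _root_.Literature.AnabelianGeometry.AbsoluteAnabelian.LocObj Λ),
          (∀ x ∈ Λ₁.toSubgroup, g * x * g⁻¹ ∈ Λ₂.toSubgroup) →
          ((Literature.Geometry.Manifold.QuotientManifold.conjSubgroup g Λ₁.toSubgroup).subgroupOf
            Λ₂.toSubgroup).FiniteIndex,
        ((∀ Λ' : _root_.Literature.AnabelianGeometry.AbsoluteAnabelian.LocObj Λ,
            (Λ'.toSubgroup.subgroupOf (Subgroup.normalizer (Λ'.toSubgroup : Set PSL2R))).FiniteIndex) →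
          IsIdRigid (geometricAutHolFieldFunctor
              fun Y : HolRS => Nonempty (Y ⟶ puncturedTorus Φ x₀)).EA ∧
            Literature.AnabelianGeometry.AbsoluteAnabelian.AbsTopIII.Cor_4_5
              (archLogFrobeniusData (geometricAutHolFieldFunctor
                fun Y : HolRS => Nonempty (Y ⟶ puncturedTorus Φ x₀)))
              (archTelecoreData (geometricAutHolFieldFunctor
                fun Y : HolRS => Nonempty (Y ⟶ puncturedTorus Φ x₀)))) ∧
        (((Λ.map (toPGL (n := Fin 2) (R := ℝ))).subgroupOf
            (Subgroup.normalizer ((Λ.map (toPGL (n := Fin 2) (R := ℝ)) : Subgroup PGL(2, ℝ)) :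
              Set PGL(2, ℝ)))).FiniteIndex →
          IsIdRigid (ObjectProperty.FullSubcategory
            fun Y : RC => Nonempty (Y ⟶ toRC.obj (puncturedTorus Φ x₀)))) := by
  obtain ⟨-, Λ, hPD, hC, -, -, -, ⟨e⟩, hiso, hH, hR⟩ :=
    exists_pslQuotient_iso_puncturedTorus_freeGroup Φ x₀
  obtain ⟨hfree, hfinG, hcard⟩ := exists_isFreeGroup_of_mulEquiv e
  have h2' : 2 ≤ Nat.card (IsFreeGroup.Generators Λ) := by rw [hcard]
  refine ⟨Λ, hPD, hC, ⟨e⟩, hiso, fun hfin => ⟨fun hN => ⟨?_, ?_⟩, fun hN' => ?_⟩⟩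
  · have h := isIdRigid_EA_mapsTo_pslQuotient_of_isFreeGroup Λ hfin h2' hN
    rw [hH] at h
    exact h
  · have h := cor_4_5_geometric_mapsTo_pslQuotient_of_isFreeGroup Λ hfin h2' hN
    rw [hH] at h
    exact h
  · haveI := hN'
    have h := RC.isIdRigid_mapsTo_pslQuotient_of_mulEquiv_freeGroup Λ hfin e le_rfl
    rw [hR] at h
    exact h

end HolRS

end Literature.AnabelianGeometry.AbsoluteAnabelian

end
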